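import Literature.Analysis.FluidPDE.SelfSimilarLiouville
import Literature.Analysis.FluidPDE.AxisymmetricEuler
import HarnessLib

/-!
# Liouville theorems for rotated (discretely) self-similar Type I profiles (Pineau–Vicol 2026)

Analysis/FluidPDE named-fact file. B. Pineau, V. Vicol, *On rotated backwards self-similar solutions
of the incompressible 3D Navier–Stokes equations*, arXiv:2607.09619 (2026), 85 pp. (held:
paper:arxiv-2607.09619; statements on pp. 3–7 of the text). Bib key `PineauVicol2026`.

Setting (§1.1–1.4, verbatim where quoted). The equations (1.1) are
`∂ₜu − Δu + (u·∇)u + ∇p = 0`, `∇·u = 0` (viscosity `1`, no force). `R(s) ∈ SO(3)` is "the matrix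
representing rotation by angle `s` about the `e₃`-axis" (1.6) — in the tree `rotZ s`
(`Literature.Analysis.FluidPDE.rotZ`, `R_s(x₀,x₁,x₂) = (cos s x₀ − sin s x₁, sin s x₀ + cos s x₁, x₂)`).
The *backwards rotated globally self-similar ansatz* (1.7) is
`u(x,t) = (−t)^{−1/2} R(αs) U(R(−αs) x/√(−t))`, `s = −log(−t)`, for `α ∈ ℝ` and a time-independent
profile `U : ℝ³ → ℝ³` (RSS; `α = 0` is Leray's SS ansatz (1.2)). The *backwards globally rotated
discretely self-similar ansatz* (1.13a) is `u(x,t) = (−t)^{−1/2} R(αs) U(y,s)`,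
`y = R(−αs) x/√(−t)`, `s = −log(−t)`, for a profile `U : ℝ³ × [0,S] → ℝ³` periodic in `s` with
period `S = 2 log λ > 0` (1.13b) ((α,λ)-RDSS; hierarchy `SS ⊆ RSS ⊆ DSS ⊆ RDSS`, p. 7). The Type I
upper bound (1.10) is `|u(x,t)| ≤ C_{U,0}/(|x| + √(−t))` for all `(x,t) ∈ ℝ³ × [−1,0)` (Remark 1.3:
`C_{U,0}` does not depend on `α`).

**Conjecture 1.1** (Perelman; Tsai GSM 192 Conj. 8.9 = Bradshaw–Tsai OP 5.2): for `α ≠ 0`, a smooth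
solution `U` of the profile system (1.8) with `|U(y)| ≤ C_{U,0}/(1+|y|)` vanishes. Open for `α ≈ 1`.

**Theorem 1.4** (Main result for RSS solutions, p. 4, verbatim): "Let `u` be a solution of the 3D
incompressible Navier–Stokes equations on `ℝ³ × [−1,0)`, which satisfies the Type I upper bound
(1.10) for some `C_{U,0} > 0`. Assume that there exists `U ∈ C²(ℝ³)` and `α ∈ ℝ` such that `u` is
a backwards rotated globally self-similar solution of (1.1) with profile `U` (the RSS ansatz (1.7)
holds). There exists `0 < α_ = α_(C_{U,0}) ≪ 1` and `1 ≪ ᾱ = ᾱ(C_{U,0}) < ∞`, such that if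
either `|α| < α_` or `|α| > ᾱ`, then `U ≡ 0`."

**Theorem 1.7** (Main result for RDSS solutions, p. 7, verbatim): "Let `u` be a solution of the 3D
incompressible Navier–Stokes equations on `ℝ³ × [−1,0)`, which satisfies the Type I upper bound
(1.10) for some `C_{U,0} > 0`. Assume that there exist `α ∈ ℝ`, `λ > 1`, and
`U ∈ C²(ℝ³ × [0,S])` with `S = 2 log(λ)`, such that `u` is a backwards globally rotated
discretely self-similar solution of (1.1) with profile `U` (the RDSS ansatz (1.13a) holds). There
exist `α_ = α_(C_{U,0}) > 0` and `λ_ = λ_(C_{U,0}) > 1`, such that if `|α| ≤ α_` and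
`1 < λ < λ_`, then `U ≡ 0`. Moreover, there exist `ᾱ = ᾱ(C_{U,0}) > 0` and
`λ̄ = λ̄(C_{U,0}) > 1`, such that if `|α| ≥ ᾱ` and `1 < λ < λ̄^{1/(1+α²)}`, then `U ≡ 0`."
(Theorem 1.6, the DSS case `α = 0`, re-proves Chae–Wolf 2017 Thm. 1.3 = `chaeWolf2017_removing_dss`
quantitatively; it is the first half of Theorem 1.7 at `α = 0` and is not vendored separately.)

**Vendored** as `pineauVicol2026_rss_liouville` (Thm. 1.4) and `pineauVicol2026_rdss_liouville`
(Thm. 1.7), over `rotZ`, `IsClassicalNSSolutionOn` (`ClassicalSolution.lean`) and the explicit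
ansatz field `pvAnsatz α U` below ((1.7) = (1.13a) with an `s`-independent profile). Rendering
choices, each making the vendored statement *weaker or equal* to the printed one: "`u` is a
solution on `ℝ³ × [−1,0)`" is taken as a classical solution with an explicit smooth pressure,
`IsClassicalNSSolutionOn (Ico (−1) 0) 1 0 u p` (`u`, `p` jointly `C^∞` on `[−1,0) × ℝ³`; the
paper's solutions are smooth for `t < 0`, cf. Thm. 1.9 "smooth solution"); the profile regularity
`U ∈ C²` is kept as printed (`ContDiff ℝ 2`), for the RDSS profile on all of `ℝ³ × ℝ` (a superset
of `ℝ³ × [0,S]`); the conclusion `U ≡ 0` is stated on the printed domain (`U = 0`, resp. `U(y,s) = 0`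
for `s ∈ [0,S]`). The thresholds are existentially quantified functions of `C_{U,0}` exactly as
printed (no size information is asserted beyond `0 < α_`, `0 < ᾱ`, `1 < λ_`, `1 < λ̄`).

Grounds `Summit.NavierStokesRegularity.NavierStokesRegularity.Theses.DulacContraction.RDSSLiouvilleInClass`
(stmt-NavierStokesRegularity-8561: the RSS / RDSS rungs of the self-similar wall quoted in its text,
"known for |α| ≪ 1 and |α| ≫ 1: PineauVicol2026 Thm 1.4") and the wall
`TypeIDSSLiouvilleConjecture` / `RotatedTypeIDSSLiouville` (`SelfSimilarLiouville.lean`) in the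
near-identity regime; the item itself asks for EVERY `l > 1` and every rotation, which these
theorems do not give (open: `α ≈ 1`, `λ` away from `1`).

## References

* B. Pineau, V. Vicol, arXiv:2607.09619 (2026): §1.2 (1.6)–(1.10), Conjecture 1.1, Remarks 1.2–1.3,
  **Theorem 1.4** (p. 4); §1.3 (1.11), Theorem 1.6 (p. 6); §1.4 (1.13)–(1.14), **Theorem 1.7**
  (p. 7); §1.5 Theorem 1.9 (p. 8, local regularity criterion, not vendored here). [PineauVicol2026]
* T.-P. Tsai, *Lectures on Navier–Stokes equations*, GSM 192 (2018), Conjectures 8.8–8.9. [Tsai2018]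
* Z. Bradshaw, T.-P. Tsai, Comm. PDE 42 (2017), §5 Open Problems 5.1–5.2. [BradshawTsai2017CPDE]
* D. Chae, J. Wolf, Comm. PDE 42 (2017) 1359–1374 = arXiv:1610.09464, Thm. 1.3. [ChaeWolf2017RemovingDSS]
-/

noncomputable section

open MeasureTheory Set

namespace Literature.Analysis.FluidPDE

/-- Local notation for physical space `ℝ³ = EuclideanSpace ℝ (Fin 3)`. -/
local notation "ℝ³" => EuclideanSpace ℝ (Fin 3)

/-- The backwards globally rotated (discretely) self-similar ansatz field of Pineau–Vicol 2026,
(1.13a) (and (1.7) when `U` does not depend on `s`): for `t < 0`, with `s = −log(−t)`,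
`u(x,t) = (−t)^{−1/2} R(αs) U(R(−αs) x/√(−t), s)`, `R(θ) = rotZ θ` the rotation by `θ` about the
`e₃`-axis. The value for `t ≥ 0` is irrelevant (junk). [cite: PineauVicol2026, (1.7) and (1.13a) (arXiv:2607.09619 pp. 3, 7)] -/
def pvAnsatz (α : ℝ) (U : ℝ³ → ℝ → ℝ³) (t : ℝ) (x : ℝ³) : ℝ³ :=
  (Real.sqrt (-t))⁻¹ •
    rotZ (α * -Real.log (-t)) (U (rotZ (-(α * -Real.log (-t))) ((Real.sqrt (-t))⁻¹ • x)) (-Real.log (-t)))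

/-- **Pineau–Vicol 2026, Theorem 1.4 (Liouville theorem for rotated self-similar Type I profiles,
`|α| ≪ 1` or `|α| ≫ 1`).** For every `C₀ > 0` there are `α₁ > 0` ("`0 < α_ ≪ 1`") and `α₂ > 0`
("`1 ≪ ᾱ < ∞`"), depending only on `C₀`, such that: if `(u, p)` is a classical solution of
Navier–Stokes (`ν = 1`, `f = 0`) on the time set `[−1, 0)` obeying the Type I upper bound
`‖u(t,x)‖ ≤ C₀/(‖x‖ + √(−t))` on `ℝ³ × [−1,0)` (1.10), and `u` is backwards rotated globally
self-similar with angular speed `α` and a profile `U ∈ C²(ℝ³)` — `u(x,t) = (−t)^{−1/2} R(αs)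
U(R(−αs)x/√(−t))`, `s = −log(−t)` (1.7) — then `|α| < α₁` or `|α| > α₂` forces `U ≡ 0`.
(Resolves Conjecture 1.1 = Tsai GSM 192 Conj. 8.9 for small and large `|α|`; `α ≈ 1` open.) [cite: PineauVicol2026, Theorem 1.4 (arXiv:2607.09619 p. 4)] -/
def pineauVicol2026_rss_liouville : Prop :=
  ∀ C₀ : ℝ, 0 < C₀ → ∃ α₁ α₂ : ℝ, 0 < α₁ ∧ 0 < α₂ ∧
    ∀ (α : ℝ) (u : ℝ → ℝ³ → ℝ³) (p : ℝ → ℝ³ → ℝ) (U : ℝ³ → ℝ³),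
      IsClassicalNSSolutionOn (Ico (-1) 0) 1 0 u p →
      (∀ t ∈ Ico (-1 : ℝ) 0, ∀ x : ℝ³, ‖u t x‖ ≤ C₀ / (‖x‖ + Real.sqrt (-t))) →
      ContDiff ℝ 2 U →
      (∀ t ∈ Ico (-1 : ℝ) 0, ∀ x : ℝ³, u t x = pvAnsatz α (fun y _ => U y) t x) →
      (|α| < α₁ ∨ α₂ < |α|) → U = 0

/-- **Pineau–Vicol 2026, Theorem 1.7 (Liouville theorem for rotated discretely self-similar Type I
profiles with factor `λ` close to `1`).** For every `C₀ > 0`: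
(i) there are `α₁ > 0` and `c₁ > 1` such that, if `(u, p)` is a classical solution of Navier–Stokes
(`ν = 1`, `f = 0`) on the time set `[−1,0)` with the Type I upper bound
`‖u(t,x)‖ ≤ C₀/(‖x‖ + √(−t))` on `ℝ³ × [−1,0)` (1.10), and `u` is backwards globally rotated
discretely self-similar with angular speed `α`, factor `c > 1` and a profile
`U ∈ C²` periodic in `s` with period `S = 2 log c` — `u(x,t) = (−t)^{−1/2} R(αs) U(R(−αs)x/√(−t), s)`,
`s = −log(−t)` (1.13a–b) — then `|α| ≤ α₁` and `1 < c < c₁` force `U ≡ 0` on `ℝ³ × [0,S]`;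
(ii) there are `α₂ > 0` and `c₂ > 1` such that, under the same hypotheses, `|α| ≥ α₂` and
`1 < c < c₂^{1/(1+α²)}` force `U ≡ 0` on `ℝ³ × [0,S]`.
(The case `α = 0` of (i) is Theorem 1.6 = Chae–Wolf 2017 Thm. 1.3.) [cite: PineauVicol2026, Theorem 1.7 (arXiv:2607.09619 p. 7)] -/
def pineauVicol2026_rdss_liouville : Prop :=
  ∀ C₀ : ℝ, 0 < C₀ →
    (∃ α₁ c₁ : ℝ, 0 < α₁ ∧ 1 < c₁ ∧
      ∀ (α c : ℝ) (u : ℝ → ℝ³ → ℝ³) (p : ℝ → ℝ³ → ℝ) (U : ℝ³ → ℝ → ℝ³),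
        |α| ≤ α₁ → 1 < c → c < c₁ →
        IsClassicalNSSolutionOn (Ico (-1) 0) 1 0 u p →
        (∀ t ∈ Ico (-1 : ℝ) 0, ∀ x : ℝ³, ‖u t x‖ ≤ C₀ / (‖x‖ + Real.sqrt (-t))) →
        ContDiff ℝ 2 (fun q : ℝ³ × ℝ => U q.1 q.2) →
        (∀ (y : ℝ³) (s : ℝ), U y (s + 2 * Real.log c) = U y s) →
        (∀ t ∈ Ico (-1 : ℝ) 0, ∀ x : ℝ³, u t x = pvAnsatz α U t x) →
        ∀ (y : ℝ³), ∀ s ∈ Icc (0 : ℝ) (2 * Real.log c), U y s = 0) ∧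
    (∃ α₂ c₂ : ℝ, 0 < α₂ ∧ 1 < c₂ ∧
      ∀ (α c : ℝ) (u : ℝ → ℝ³ → ℝ³) (p : ℝ → ℝ³ → ℝ) (U : ℝ³ → ℝ → ℝ³),
        α₂ ≤ |α| → 1 < c → c < c₂ ^ (1 / (1 + α ^ 2)) →
        IsClassicalNSSolutionOn (Ico (-1) 0) 1 0 u p →
        (∀ t ∈ Ico (-1 : ℝ) 0, ∀ x : ℝ³, ‖u t x‖ ≤ C₀ / (‖x‖ + Real.sqrt (-t))) →
        ContDiff ℝ 2 (fun q : ℝ³ × ℝ => U q.1 q.2) →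
        (∀ (y : ℝ³) (s : ℝ), U y (s + 2 * Real.log c) = U y s) →
        (∀ t ∈ Ico (-1 : ℝ) 0, ∀ x : ℝ³, u t x = pvAnsatz α U t x) →
        ∀ (y : ℝ³), ∀ s ∈ Icc (0 : ℝ) (2 * Real.log c), U y s = 0)

/-! ### Sanity lemmas (bookkeeping only) -/

/-- At `t = −1` (`s = 0`, `R(0) = 1`) the ansatz field is the profile slice `U(·, 0)`. [cite: PineauVicol2026, Remark 1.3 ("at the initial time t = −1 we have s = 0 and R(0) = Id")] -/
theorem pvAnsatz_neg_one (α : ℝ) (U : ℝ³ → ℝ → ℝ³) (x : ℝ³) :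
    pvAnsatz α U (-1) x = U x 0 := by
  simp [pvAnsatz]

/-- Theorem 1.7 (i) at `α = 0` contains the DSS statement of Theorem 1.6 in the same rendering:
for every `C₀ > 0` there is `c₁ > 1` such that (0,c)-RDSS = `c`-DSS Type I classical solutions on
`[−1,0)` with `1 < c < c₁` have vanishing profile. [cite: PineauVicol2026, Theorem 1.6 (arXiv:2607.09619 p. 6)] -/
theorem pineauVicol2026_rdss_liouville.dss (h : pineauVicol2026_rdss_liouville) {C₀ : ℝ}
    (hC₀ : 0 < C₀) : ∃ c₁ : ℝ, 1 < c₁ ∧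
      ∀ (c : ℝ) (u : ℝ → ℝ³ → ℝ³) (p : ℝ → ℝ³ → ℝ) (U : ℝ³ → ℝ → ℝ³), 1 < c → c < c₁ →
        IsClassicalNSSolutionOn (Ico (-1) 0) 1 0 u p →
        (∀ t ∈ Ico (-1 : ℝ) 0, ∀ x : ℝ³, ‖u t x‖ ≤ C₀ / (‖x‖ + Real.sqrt (-t))) →
        ContDiff ℝ 2 (fun q : ℝ³ × ℝ => U q.1 q.2) →
        (∀ (y : ℝ³) (s : ℝ), U y (s + 2 * Real.log c) = U y s) →
        (∀ t ∈ Ico (-1 : ℝ) 0, ∀ x : ℝ³, u t x = pvAnsatz 0 U t x) →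
        ∀ (y : ℝ³), ∀ s ∈ Icc (0 : ℝ) (2 * Real.log c), U y s = 0 := by
  obtain ⟨⟨α₁, c₁, hα₁, hc₁, H⟩, -⟩ := h C₀ hC₀
  exact ⟨c₁, hc₁, fun c u p U h1 h2 => H 0 c u p U (by simpa using hα₁.le) h1 h2⟩

end Literature.Analysis.FluidPDE

end
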